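/-
Origin: expansion seat `planner-pub-hodgecm-qw8-g11-0`, handover #8 REPLACE (DOC-ONLY) md5 fb8e1b90b7de1d79c95bbd6a734385cb (313 l.) SUPERSEDES tree `HodgeCM/Model/Toy/LefWitness.lean` 59ea3d29 (308 l.): docstrings added to every undocumented theorem/def (CONVENTIONS §3 debt → 0), comment-stripped code IDENTICAL to the tree copy (residue md5 0c4adbb1; no declaration, statement or proof changed); imports unchanged (Mathlib, HodgeCM.Model.Toy.LefModelAxioms; NO r (`HOME/pub-hodgecm-qw8-g11/lean/Qw8g11/LefWitness.lean`, md5 fb8e1b90, 313 lines);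
landed by the packager successor (mc-unitary-1-g3, gen-8 kit) in gate run 32 REPLACES the earlier landed copy of `HodgeCM/Model/Toy/LefWitness.lean` (seat copy carried the packager origin header of the earlier run (stripped)).
-/
-- HANDOVER (planner-pub-hodgecm-qw8-g6-0, unit pub-hodgecm-qw8-g6): WIP module `Qw8g6.LefWitness`; intended final module
-- `HodgeCM.Model.Toy.LefWitness` (kind L5, separating model); rename `import Qw8g6.X` ↦ `import HodgeCM.Model.Toy.X`.
/-
Copyright: pub-hodgecm cell (HodgeCMPerL). Separating-model layer (gens 5–6 of the [QW8] §2.5 lineage). New file.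

# The Lefschetz model separates `RealisationExistsFace` from the descent facts

`HodgeCM.Model.Toy.LefModel` / `HodgeCM.Model.Toy.LefModelAxioms` proved that the Lefschetz model `lefModel` (exterior CM-model,
`Alg := Hdg ∩ Bal`, the corner product `P7 = ∏ A_{(ℚ(ζ₇), Φⱼ)}` of a face of `ℚ(ζ₇)` declared CM) satisfies
`ModelAxioms` and EVERY generic binder N1–N4, F4, F5, F-H0, F7d-B, `Fact_dimProd` of the kernel-checked assembly
`HodgeCM.Assembly.COR_CM_of_descentFactsB`.
Here we prove that COR-CM FAILS in it:

* `exists_twist_eq` — `Aut_ℚ(ℚ̄)` acts transitively on the complex embeddings of a number field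
  (`AlgHom.liftNormal` over the normal extension `ℚ̄/ℚ`);
* `typ_r` — the Galois type of the eigen-index `(slot j, σ)` of the corner product `∏ A_{(K,Φⱼ)}` is
  `{γ | γ•σ ∈ Φⱼ}`; hence (`not_bal_r`) the index map `r σ = ((0,σ),(1,σ),(2,σ),(3,σ))` of the Weil generator
  `g_σ` is UNBALANCED as soon as no corner is the conjugate `Φ̄₀` of the first — which holds for the four corners
  of every face of a CM field of degree `> 4` (`corner_ne_compl`; in degree `4` the corner `Φ^{(ππ')}` IS `Φ̄`);
* so the rational Weil class `δ(1) = Σ_σ g_σ ≠ 0` (`HodgeCM.Toy.delta`, M15) has `Θ(δ(1) ⊗ 1) ∈ unbSpan`, is not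
  balanced, hence not `lefModel`-algebraic, although it is a Hodge class (M16): `¬ lefModel.HC P7`,
  `¬ lefModel.HC_CM`, `¬ lefModel.WeilFaceAlgebraic K f` for every face in degree `> 4`, and — by the assembly
  itself — `¬ lefModel.RealisationExistsFace`.

HEADLINE `descentFactsB_not_sufficient`: the conjunction of `ModelAxioms` and the nine generic descent facts does
NOT imply COR-CM; the realisation input of `COR_CM_of_descentFactsB` is load-bearing (it fails in a model of
everything else).  Nothing here is cited: kernel facts about an explicit model.
-/
import Mathlib
import Summits.HodgeConjecture.HodgeCM.Model.Toy.LefModelAxioms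

noncomputable section

set_option backward.isDefEq.respectTransparency false

namespace HodgeCM.Toy

open scoped TensorProduct
open exteriorPower Module CMPresentation CMTypeOps
open NumberField.ComplexEmbedding (conjugate)
open Literature.AlgebraicGeometry.Motives
open Literature.AlgebraicGeometry.Motives.HodgeStructure (ofRat ofRat_apply mem_hodgeClasses_iff)

/-! ### 1. `Aut_ℚ(ℚ̄)` acts transitively on the complex embeddings of a number field -/

section Twist

variable {K : Type} [Field K] [NumberField K]

/-- the image `σ x` of an element of a number field `K` under a complex embedding `σ` lies in `ℚ̄ ⊂
ℂ` (`x` is algebraic over `ℚ`, and so is `σ x`) -/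
theorem ringHom_apply_mem_Qbar (σ : K →+* ℂ) (x : K) : σ x ∈ Qbar := by
  show σ x ∈ algebraicClosure ℚ ℂ
  rw [mem_algebraicClosure_iff]
  exact (Algebra.IsAlgebraic.isAlgebraic x).algHom σ.toRatAlgHom

/-- a complex embedding of a number field, with values in `ℚ̄ ⊂ ℂ` -/
def liftK (σ : K →+* ℂ) : K →+* Qbar := σ.codRestrict Qbar (ringHom_apply_mem_Qbar σ)

/-- the `ℚ̄`-valued lift `liftK σ` agrees with `σ` after the coercion `ℚ̄ → ℂ` -/
@[simp] theorem coe_liftK (σ : K →+* ℂ) (x : K) : ((liftK σ x : Qbar) : ℂ) = σ x := rfl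

/-- the Galois twist `γ • σ := γ ∘ σ` of a complex embedding by `γ ∈ Aut_ℚ(ℚ̄)` -/
def twist (γ : Gam) (σ : K →+* ℂ) : K →+* ℂ :=
  (algebraMap Qbar ℂ).comp (γ.toRingEquiv.toRingHom.comp (liftK σ))

/-- unfolding of the Galois twist: `twist γ σ x = γ (σ x)`, read in `ℂ` -/
theorem twist_apply (γ : Gam) (σ : K →+* ℂ) (x : K) : twist γ σ x = ((γ (liftK σ x) : Qbar) : ℂ) := rfl

/-- **Transitivity.** Any two complex embeddings `σ, τ` of a number field differ by an automorphism of `ℚ̄`: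
`τ ∘ σ⁻¹ : σ(K) → ℚ̄` extends to the normal extension `ℚ̄/ℚ` (`AlgHom.liftNormal`), and an endomorphism of the
algebraic extension `ℚ̄/ℚ` is an automorphism (`AlgHom.normal_bijective`). -/
theorem exists_twist_eq (σ τ : K →+* ℂ) : ∃ γ : Gam, twist γ σ = τ := by
  let σQ : K →ₐ[ℚ] Qbar := (liftK σ).toRatAlgHom
  let τQ : K →ₐ[ℚ] Qbar := (liftK τ).toRatAlgHom
  let K₁ : IntermediateField ℚ Qbar := σQ.fieldRange
  let e₁ : K ≃ₐ[ℚ] K₁ :=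
    (AlgEquiv.ofInjectiveField σQ).trans (Subalgebra.equivOfEq _ _ (AlgHom.fieldRange_toSubalgebra σQ).symm)
  let ϕ : K₁ →ₐ[ℚ] Qbar := τQ.comp (e₁.symm : K₁ →ₐ[ℚ] K)
  let γ₀ : Qbar →ₐ[ℚ] Qbar := ϕ.liftNormal Qbar
  refine ⟨AlgEquiv.ofBijective γ₀ (AlgHom.normal_bijective ℚ Qbar Qbar γ₀), RingHom.ext fun x => ?_⟩
  have hx : algebraMap K₁ Qbar (e₁ x) = liftK σ x := rfl
  have h1 : γ₀ (liftK σ x) = liftK τ x := by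
    have h : γ₀ (algebraMap K₁ Qbar (e₁ x)) = ϕ (e₁ x) := ϕ.liftNormal_commutes Qbar (e₁ x)
    rw [hx] at h
    rw [h]
    show τQ (e₁.symm (e₁ x)) = liftK τ x
    rw [AlgEquiv.symm_apply_apply]
    rfl
  rw [twist_apply, AlgEquiv.ofBijective_apply, h1, coe_liftK]

/-- **Galois type of a presented index.** If the CM-type set of the atom under the index `s` is the pull-back of
`Ψ ⊆ Hom(K, ℂ)` along `e : K → F_{s}` and `s.2 ∘ e = σ`, then `typ s = {γ | γ•σ ∈ Ψ}`. -/
theorem Obj.typ_eq_of_presentation (X : Obj) (s : X.Idx) (e : K →+* (X.atom s.1).F) (σ : K →+* ℂ)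
    (Ψ : Set (K →+* ℂ)) (hΦ : ∀ τ : (X.atom s.1).F →+* ℂ, τ ∈ (X.atom s.1).Φ ↔ τ.comp e ∈ Ψ)
    (hσ : ∀ x, s.2 (e x) = σ x) : X.typ s = {γ | twist γ σ ∈ Ψ} := by
  ext γ
  rw [Obj.mem_typ, Set.mem_setOf_eq]
  show (X.gact γ s).2 ∈ (X.atom s.1).Φ ↔ _
  have key : (X.gact γ s).2.comp e = twist γ σ := by
    refine RingHom.ext fun x => ?_
    show ((γ (X.liftE s (e x)) : Qbar) : ℂ) = ((γ (liftK σ x) : Qbar) : ℂ)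
    have h : X.liftE s (e x) = liftK σ x := Subtype.ext (hσ x)
    rw [h]
  rw [hΦ, key]

end Twist

/-! ### 2. The eigen-indices of a Weil generator of a genuine corner product are unbalanced -/

section Corner

variable (K : CMField) (Φ : Fin 4 → CMType K)

/-- the Galois type of the index `(slot j, σ)` of `P = ∏ⱼ A_{(K,Φⱼ)}` is `{γ | γ•σ ∈ Φⱼ}` -/
theorem typ_r (σ : K →+* ℂ) : ∀ j : Fin 4, (PP K Φ).typ (r K Φ σ j) = {γ | twist γ σ ∈ (Φ j).1}
  | 0 => Obj.typ_eq_of_presentation (PP K Φ) (r K Φ σ 0) (eK K : K →+* FK K) σ (Φ 0).1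
      (fun _ => Iff.rfl) (embOf_apply_eK K σ)
  | 1 => Obj.typ_eq_of_presentation (PP K Φ) (r K Φ σ 1) (eK K : K →+* FK K) σ (Φ 1).1
      (fun _ => Iff.rfl) (embOf_apply_eK K σ)
  | 2 => Obj.typ_eq_of_presentation (PP K Φ) (r K Φ σ 2) (eK K : K →+* FK K) σ (Φ 2).1
      (fun _ => Iff.rfl) (embOf_apply_eK K σ)
  | 3 => Obj.typ_eq_of_presentation (PP K Φ) (r K Φ σ 3) (eK K : K →+* FK K) σ (Φ 3).1
      (fun _ => Iff.rfl) (embOf_apply_eK K σ)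

variable {K Φ} in
/-- **unbalancedness**: if no corner type is the conjugate `Φ̄₀` of the first, every index map `r σ` of a Weil
generator is unbalanced — the type `T = typ (0,σ)` occurs (at slot `0`) but `Tᶜ` never does, because
`typ (j,σ) = Tᶜ` would force `Φⱼ = Φ̄₀` by transitivity (`exists_twist_eq`). -/
theorem not_bal_r (hΦ : ∀ j : Fin 4, (Φ j).1 ≠ ((Φ 0).1)ᶜ) (σ : K →+* ℂ) : ¬ (PP K Φ).Bal (r K Φ σ) := by
  classical
  intro hbal
  have h := hbal ((PP K Φ).typ (r K Φ σ 0))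
  have h1 : 0 < (PP K Φ).tcnt (r K Φ σ) ((PP K Φ).typ (r K Φ σ 0)) := by
    rw [Obj.tcnt_eq_card_filter, Finset.card_pos]
    exact ⟨0, Finset.mem_filter.mpr ⟨Finset.mem_univ _, rfl⟩⟩
  have h2 : (PP K Φ).tcnt (r K Φ σ) ((PP K Φ).typ (r K Φ σ 0))ᶜ = 0 := by
    rw [Obj.tcnt_eq_card_filter, Finset.card_eq_zero, Finset.filter_eq_empty_iff]
    intro j _ hj
    rw [typ_r, typ_r] at hj
    apply hΦ j
    ext ρ
    obtain ⟨γ, rfl⟩ := exists_twist_eq σ ρ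
    have hγ := Set.ext_iff.mp hj γ
    simpa only [Set.mem_setOf_eq, Set.mem_compl_iff] using hγ
  omega

end Corner

/-! ### 3. Faces of a CM field of degree `> 4` are genuine: no corner is `Φ̄` -/

section FaceGenuine

variable {K : Type} [Field K] [NumberField K]

/-- in degree `> 4` some complex embedding lies over neither of the two places of a face -/
theorem exists_not_mem_placeSets (f : Face K) (h4 : 4 < Module.finrank ℚ K) :
    ∃ ρ : K →+* ℂ, ρ ∉ placeSet f.p ∧ ρ ∉ placeSet f.p' := by
  classical
  by_contra hne
  push Not at hne
  have hsub : (Finset.univ : Finset (K →+* ℂ)) ⊆ {f.p, conjugate f.p, f.p', conjugate f.p'} := by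
    intro ρ _
    simp only [Finset.mem_insert, Finset.mem_singleton]
    by_cases h : ρ ∈ placeSet f.p
    · rcases h with h | h
      · exact Or.inl h
      · exact Or.inr (Or.inl h)
    · rcases hne ρ h with h' | h'
      · exact Or.inr (Or.inr (Or.inl h'))
      · exact Or.inr (Or.inr (Or.inr h'))
  have hcard := Finset.card_le_card hsub
  rw [Finset.card_univ, NumberField.Embeddings.card] at hcard
  have h4' : ({f.p, conjugate f.p, f.p', conjugate f.p'} : Finset (K →+* ℂ)).card ≤ 4 := Finset.card_le_four
  omega

/-- **genuineness of faces**: for a face `(Φ; π, π')` of a CM field of degree `> 4`, none of the four corners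
`Φ, Φ̄^{(π)}, Φ̄^{(π')}, Φ^{(ππ')}` is the conjugate type `Φ̄` (for `Φ^{(ππ')}` this uses an embedding over a
third place; in degree `4` it would fail). -/
theorem corner_ne_compl (f : Face K) (h4 : 4 < Module.finrank ℚ K) :
    ∀ j : Fin 4, (f.corner j).1 ≠ ((f.corner 0).1)ᶜ := by
  obtain ⟨ρ, hρ, hρ'⟩ := exists_not_mem_placeSets f h4
  have hp : f.p ∈ placeSet f.p := Set.mem_insert _ _
  have hp' : f.p' ∈ placeSet f.p' := Set.mem_insert _ _
  intro j h
  have key := fun φ : K →+* ℂ => Set.ext_iff.mp h φ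
  match j with
  | 0 =>
    have k := key ρ
    simp only [Face.corner, Set.mem_compl_iff] at k
    exact iff_not_self k
  | 1 =>
    have k := key f.p
    simp only [Face.corner, Set.mem_compl_iff, mem_flip_iff, mem_bar_iff] at k
    tauto
  | 2 =>
    have k := key f.p'
    simp only [Face.corner, Set.mem_compl_iff, mem_flip_iff, mem_bar_iff] at k
    tauto
  | 3 =>
    have k := key ρ
    simp only [Face.corner, Set.mem_compl_iff, mem_flip_iff] at k
    tauto

end FaceGenuine

/-! ### 4. The Weil class `δ(x)` of a genuine corner product is not balanced -/

section Delta

variable (D : HodgeData) (K : CMField) (Φ : Fin 4 → CMType K)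

/-- `Θ(δ(x) ⊗ 1) = Σ_σ σ(x) e_{r σ}` lies in the unbalanced span when every `r σ` is unbalanced -/
theorem theta_ofRat_delta_mem_unbSpan (hunb : ∀ σ : K →+* ℂ, ¬ (PP K Φ).Bal (r K Φ σ)) (x : FK K) :
    (PP K Φ).Θ 4 (ofRat (delta D K Φ x) : (toyModelWith D).CohC ((toyModelWith D).prod4 K Φ) 4) ∈
      (PP K Φ).unbSpan 4 := by
  rw [ofRat_delta, ← Equiv.sum_comp (embEquiv K).symm, map_sum]
  refine Submodule.sum_mem _ fun σ _ => ?_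
  rw [LinearEquiv.map_smul]
  refine Submodule.smul_mem _ _ ?_
  have h : (PP K Φ).Θ 4 (g' D K Φ ((embEquiv K).symm σ)) = (PP K Φ).mono 4 (r K Φ σ) := theta_g D K Φ σ
  rw [h]
  exact (PP K Φ).mono_mem_unbSpan (hunb σ)

/-- … hence `δ(x) ∉ Bal⁴(P)` for `x ≠ 0` (`balSpan ∩ unbSpan = 0`, `δ` injective). -/
theorem delta_not_mem_balQ (hunb : ∀ σ : K →+* ℂ, ¬ (PP K Φ).Bal (r K Φ σ)) {x : FK K} (hx : x ≠ 0) :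
    delta D K Φ x ∉ (PP K Φ).balQ 4 := by
  intro hb
  rw [Obj.mem_balQ] at hb
  have hu := theta_ofRat_delta_mem_unbSpan D K Φ hunb x
  have h0 : (PP K Φ).Θ 4 (ofRat (delta D K Φ x) : (toyModelWith D).CohC ((toyModelWith D).prod4 K Φ) 4) = 0 :=
    Submodule.disjoint_def.mp ((PP K Φ).disjoint_balSpan_unbSpan 4) _ hb hu
  rw [LinearEquiv.map_eq_zero_iff, ofRat_apply] at h0
  have hδ : delta D K Φ x = 0 := ofRat_injective (h0.trans (TensorProduct.tmul_zero _ (1 : ℂ)).symm)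
  exact hx (delta_injective D K Φ (hδ.trans (map_zero _).symm))

/-- for the corner product of a face of a CM field of degree `> 4`: `δ(1) ∉ Bal⁴` -/
theorem delta_one_not_mem_balQ_face (f : Face K) (h4 : 4 < Module.finrank ℚ K) :
    delta D K f.corner 1 ∉ (PP K f.corner).balQ 4 :=
  delta_not_mem_balQ D K f.corner (not_bal_r (corner_ne_compl f h4)) one_ne_zero

end Delta

/-! ### 5. The witness: COR-CM fails in `lefModel` -/

/-- the Weil line of a genuine face is NOT `lefModel`-algebraic (any CM field of degree `> 4`) -/
theorem not_weilFaceAlgebraic_lefModel (K : CMField) (f : Face K) (h4 : 4 < Module.finrank ℚ K) :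
    ¬ lefModel.WeilFaceAlgebraic K f := by
  intro h
  rw [lefModel_eq, Universe.balMod_weilFaceAlgebraic_iff] at h
  have h2 := (Submodule.mem_inf.mp (h (delta_mem exteriorHodgeData K f.corner 1))).2
  change delta exteriorHodgeData K f.corner 1 ∈ (PP K f.corner).balQ 4 at h2
  exact delta_one_not_mem_balQ_face exteriorHodgeData K f h4 h2

/-- the cyclotomic field `ℚ(ζ₇)` has degree `> 4` over `ℚ` (its degree is `6`, `cyclo7_finrank`) -/
theorem four_lt_finrank_cyclo7 : 4 < Module.finrank ℚ cyclo7 := by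
  rw [cyclo7_finrank]; norm_num

/-- `δ(1)` on `P7` is a rational Hodge class (M16) … -/
theorem delta_one_mem_hodgeClasses_P7 :
    delta exteriorHodgeData cyclo7 f7.corner 1 ∈ lefModel.hodgeClassesOf P7 2 := by
  rw [lef_hodgeClassesOf]
  exact fact_weilLine_hodge exteriorHodgeData cyclo7 f7 (delta_mem exteriorHodgeData cyclo7 f7.corner 1)

/-- … which is not `lefModel`-algebraic -/
theorem delta_one_not_mem_lef_alg_P7 : delta exteriorHodgeData cyclo7 f7.corner 1 ∉ lefModel.alg P7 2 := by
  intro hx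
  rw [lef_alg_eq] at hx
  have h2 := (Submodule.mem_inf.mp hx).2
  change delta exteriorHodgeData cyclo7 f7.corner 1 ∈ (PP cyclo7 f7.corner).balQ 4 at h2
  exact delta_one_not_mem_balQ_face exteriorHodgeData cyclo7 f7 four_lt_finrank_cyclo7 h2

/-- **`HC(P7)` fails in the Lefschetz model.** -/
theorem not_hc_P7_lefModel : ¬ lefModel.HC P7 := fun h =>
  delta_one_not_mem_lef_alg_P7 (h 2 delta_one_mem_hodgeClasses_P7)

/-- `P7` is declared a CM abelian variety of `lefModel` -/
theorem isCMAbelianVariety_P7_lefModel : lefModel.IsCMAbelianVariety P7 := (lef_isCM_iff P7).mpr (Or.inr rfl)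

/-- **COR-CM fails in the Lefschetz model.** -/
theorem not_hc_cm_lefModel : ¬ lefModel.HC_CM := fun h =>
  not_hc_P7_lefModel (h P7 isCMAbelianVariety_P7_lefModel)

/-- the Weil line of the face `f7` of `ℚ(ζ₇)` is not `lefModel`-algebraic -/
theorem not_weilFaceAlgebraic_f7_lefModel : ¬ lefModel.WeilFaceAlgebraic cyclo7 f7 :=
  not_weilFaceAlgebraic_lefModel cyclo7 f7 four_lt_finrank_cyclo7

/-- **the realisation input fails in the Lefschetz model** — by the kernel-checked assembly
`Assembly.COR_CM_of_descentFactsB` itself, since every other binder holds (`lefModel_descentFactsB`). -/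
theorem not_realisationExistsFace_lefModel : ¬ lefModel.RealisationExistsFace := fun hR =>
  not_hc_cm_lefModel (Assembly.COR_CM_of_descentFactsB lefModel lefModel_modelAxioms hR lef_cupExterior
    lef_cup_hodge lef_pull_H0 lef_hodge_F0 lef_cupAlg lef_cupAssoc lef_unitH0 lef_gysinDescentB lef_dimProd)

/-- **HEADLINE (separation).** The binders of `Assembly.COR_CM_of_descentFactsB` other than the realisation
input — `ModelAxioms`, N1 `Fact_cupExterior`, N2 `Fact_cup_hodge`, N3 `Fact_pull_H0`, N4 `Fact_hodge_F0`,
F4 `Fact_cupAlg`, F5 `Fact_cupAssoc`, F-H0 `Fact_unitH0`, F7d-B `Fact_gysinDescentB`, `Fact_dimProd` — do NOT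
imply COR-CM: they hold in the Lefschetz model, where `HC_CM`, `RealisationExistsFace` and the algebraicity of
the Weil line of a face all fail. -/
theorem descentFactsB_not_sufficient :
    ∃ U : Universe, U.ModelAxioms ∧ U.Fact_cupExterior ∧ U.Fact_cup_hodge ∧ U.Fact_pull_H0 ∧ U.Fact_hodge_F0 ∧
      U.Fact_cupAlg ∧ U.Fact_cupAssoc ∧ U.Fact_unitH0 ∧ U.Fact_gysinDescentB ∧ U.Fact_dimProd ∧
      ¬ U.HC_CM ∧ ¬ U.RealisationExistsFace ∧ ∃ (K : CMField) (f : Face K), ¬ U.WeilFaceAlgebraic K f :=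
  ⟨lefModel, lefModel_modelAxioms, lef_cupExterior, lef_cup_hodge, lef_pull_H0, lef_hodge_F0, lef_cupAlg,
    lef_cupAssoc, lef_unitH0, lef_gysinDescentB, lef_dimProd, not_hc_cm_lefModel,
    not_realisationExistsFace_lefModel, cyclo7, f7, not_weilFaceAlgebraic_f7_lefModel⟩

end HodgeCM.Toy

end
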